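import Literature.Analysis.FluidPDE.AxisymOmegaThetaEnergy
import Literature.Analysis.FluidPDE.AxisymPoloidalCutoff
import Literature.Analysis.FluidPDE.AxisymPoloidalPart
import Literature.Analysis.FluidPDE.TaoEnstrophyLocalisationProofs
import Literature.Analysis.FluidPDE.SobolevWholeSpace
import Literature.Analysis.FluidPDE.EnergyToolkit
import HarnessLib

/-!
# Lei–Zhang 2017, Thm. 1.4: the `L⁴` bound of the velocity from `‖V²‖₂`, `‖ω^θ‖₂`, `‖Γ‖_∞`
# (swirl part + poloidal part)

Analysis/FluidPDE proof file (theorems only; no definitions, no named facts) on the discharge path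
of the named fact `Literature.Analysis.FluidPDE.LeiZhang2017_smallSwirl_regularity`
(Lei–Zhang 2017, Thm. 1.4).

For an axisymmetric velocity `u` write `u = Φ J x + b` with `Φ = u^θ/r = angVelQuot u`,
`J x = (−x₁, x₀, 0)` (so `Φ J x = u^θ e_θ`) and the poloidal part `b = uʳ e_r + u^z e_z`.
Then `b` is axisymmetric, swirl free and divergence free with `curl b = ω^θ e_θ`, hence
`‖∇b‖₂ ≤ ‖curl b‖₂ = ‖ω^θ‖₂ = ‖rΩ‖₂` (the `div`–`curl` estimate), `‖b‖₆ ≤ K‖∇b‖₂` (Sobolev) and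
`‖b‖₄⁴ ≤ ‖b‖₂‖b‖₆³`; while `‖Φ J‖₄⁴ = ∫ r⁴Φ⁴ ≤ ∫ r²Φ⁴ + ‖Γ‖²_∞‖u‖₂²` (`r²Φ = Γ`).  This turns the
a-priori bounds of `AxisymSmallSwirlBootstrap` (`‖V²‖₂² = ∫r²Φ⁴ ≤ E₀`) and `AxisymOmegaThetaGronwall`
(`‖ω^θ‖₂²`) into a bound of `‖u(t)‖_{L⁴}` in Tao's class:

* `IsTaoSolutionOn.eLpNorm_four_le_of_bounds`.

## Mathlib / tree search

Tree: `norm_curl_sq_eq_swirlVelocity_sq`, `swirl_fun_smul` (`AxisymPoloidalCutoff`),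
`fderiv_apply_rotGen_eq_zero_of_forall_rotZ` (`AxisymPoloidalPart`), `rotGen_rotZ`, `curl_apply_two`
(`AxisymNoSwirlVorticity`), `lintegral_frobeniusNormSq_fderiv_le_lintegral_sq_norm_curl`
(`TaoEnstrophyLocalisationProofs`), `sq_opNorm_le_frobeniusNormSq`, `eLpNorm_six_le_eLpNorm_fderiv_two`
(`SobolevWholeSpace`), `integral_norm_pow_four_le` (`EnergyToolkit`), `volume_axis_eq_zero`
(`AxisymWeights`), `IsTaoSolutionOn.lintegral_enorm_sq_le` (`TaoClassGlue`),
`IsAxisymmetric.cylRadius_mul_abs_angVelQuot_le` (`AxisymOmegaThetaEnergy`).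

## References

* Z. Lei, Q. S. Zhang, Pacific J. Math. 289 (2017) 169–187, arXiv:1505.02628, §4 (p. 10).
  [`LeiZhang2017`]
-/

noncomputable section

open MeasureTheory Set Function Filter Topology InnerProductSpace WithLp
open scoped RealInnerProductSpace Laplacian ContDiff ENNReal NNReal

namespace Literature.Analysis.FluidPDE

/-! ### The swirl carrier `Φ J x` -/

section Carrier

variable {Φ : EuclideanSpace ℝ (Fin 3) → ℝ}

/-- `swirl J = x₀² + x₁²`. [folklore] -/
theorem swirl_rotGenL (x : EuclideanSpace ℝ (Fin 3)) :
    swirl (fun y : EuclideanSpace ℝ (Fin 3) => rotGenL y) x = x 0 ^ 2 + x 1 ^ 2 := by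
  simp only [swirl, rotGenL_apply, rotGen_apply_zero, rotGen_apply_one]; ring

/-- `swirl (Φ J) = (x₀² + x₁²) Φ`. [folklore] -/
theorem swirl_smul_rotGenL (Φ : EuclideanSpace ℝ (Fin 3) → ℝ) (x : EuclideanSpace ℝ (Fin 3)) :
    swirl (fun y => Φ y • rotGenL y) x = (x 0 ^ 2 + x 1 ^ 2) * Φ x := by
  rw [swirl_fun_smul, swirl_rotGenL]; ring

/-- `‖c J x‖² = (x₀² + x₁²) c²`. [folklore] -/
theorem norm_smul_rotGenL_sq (c : ℝ) (x : EuclideanSpace ℝ (Fin 3)) :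
    ‖c • rotGenL x‖ ^ 2 = (x 0 ^ 2 + x 1 ^ 2) * c ^ 2 := by
  rw [norm_smul, mul_pow, rotGenL_apply, norm_rotGen_sq, Real.norm_eq_abs, sq_abs]; ring

/-- The derivative of `Φ J`: `D(ΦJ)(x) h = (DΦ h) J x + Φ J h`. [folklore] -/
theorem hasFDerivAt_smul_rotGenL {x : EuclideanSpace ℝ (Fin 3)} (hΦ : DifferentiableAt ℝ Φ x) :
    HasFDerivAt (fun y => Φ y • rotGenL y) (Φ x • rotGenL + (fderiv ℝ Φ x).smulRight (rotGenL x)) x :=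
  hΦ.hasFDerivAt.smul rotGenL.hasFDerivAt

/-- `D(ΦJ)(x) h = (DΦ h) J x + Φ J h`, applied form. [folklore] -/
theorem fderiv_smul_rotGenL_apply {x : EuclideanSpace ℝ (Fin 3)} (hΦ : DifferentiableAt ℝ Φ x)
    (h : EuclideanSpace ℝ (Fin 3)) :
    fderiv ℝ (fun y => Φ y • rotGenL y) x h = (fderiv ℝ Φ x h) • rotGenL x + Φ x • rotGenL h := by
  rw [(hasFDerivAt_smul_rotGenL hΦ).fderiv]
  simp [ContinuousLinearMap.smulRight_apply, add_comm]

/-- `(curl (Φ J))₀ = −x₀ ∂_zΦ`. [folklore] -/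
theorem curl_smul_rotGenL_apply_zero {x : EuclideanSpace ℝ (Fin 3)} (hΦ : DifferentiableAt ℝ Φ x) :
    FluidPDE.curl (fun y => Φ y • rotGenL y) x 0 = -(x 0 * fderiv ℝ Φ x (EuclideanSpace.single 2 1)) := by
  have h : FluidPDE.curl (fun y => Φ y • rotGenL y) x 0 =
      fderiv ℝ (fun y => Φ y • rotGenL y) x (EuclideanSpace.single 1 1) 2 -
        fderiv ℝ (fun y => Φ y • rotGenL y) x (EuclideanSpace.single 2 1) 1 := by
    simp [FluidPDE.curl]
  rw [h, fderiv_smul_rotGenL_apply hΦ, fderiv_smul_rotGenL_apply hΦ]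
  simp [rotGenL_apply, rotGen]; ring

/-- `(curl (Φ J))₁ = −x₁ ∂_zΦ`. [folklore] -/
theorem curl_smul_rotGenL_apply_one {x : EuclideanSpace ℝ (Fin 3)} (hΦ : DifferentiableAt ℝ Φ x) :
    FluidPDE.curl (fun y => Φ y • rotGenL y) x 1 = -(x 1 * fderiv ℝ Φ x (EuclideanSpace.single 2 1)) := by
  have h : FluidPDE.curl (fun y => Φ y • rotGenL y) x 1 =
      fderiv ℝ (fun y => Φ y • rotGenL y) x (EuclideanSpace.single 2 1) 0 -
        fderiv ℝ (fun y => Φ y • rotGenL y) x (EuclideanSpace.single 0 1) 2 := by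
    simp [FluidPDE.curl]
  rw [h, fderiv_smul_rotGenL_apply hΦ, fderiv_smul_rotGenL_apply hΦ]
  simp [rotGenL_apply, rotGen]; ring

/-- `swirl (curl (Φ J)) = 0`. [folklore] -/
theorem swirl_curl_smul_rotGenL {x : EuclideanSpace ℝ (Fin 3)} (hΦ : DifferentiableAt ℝ Φ x) :
    swirl (FluidPDE.curl (fun y => Φ y • rotGenL y)) x = 0 := by
  simp only [swirl]
  rw [curl_smul_rotGenL_apply_zero hΦ, curl_smul_rotGenL_apply_one hΦ]; ring

/-- `div (Φ J) = DΦ[J x] = 0` for an axisymmetric scalar `Φ`. [folklore] -/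
theorem divergence_smul_rotGenL (hax : IsAxisymmetricScalar Φ) {x : EuclideanSpace ℝ (Fin 3)}
    (hΦ : DifferentiableAt ℝ Φ x) :
    VectorCalculus.divergence (fun y => Φ y • rotGenL y) x = 0 := by
  rw [divergence_eq_sum_three, fderiv_smul_rotGenL_apply hΦ, fderiv_smul_rotGenL_apply hΦ,
    fderiv_smul_rotGenL_apply hΦ]
  have h0 := fderiv_apply_rotGen_eq_zero_of_forall_rotZ (fun θ => hax θ x) hΦ
  rw [fderiv_apply_eq_sum_three Φ x (rotGen x)] at h0
  simp only [PiLp.add_apply, PiLp.smul_apply, smul_eq_mul, rotGenL_apply, rotGen_apply_zero,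
    rotGen_apply_one, rotGen_apply_two] at h0 ⊢
  simp
  linarith [h0]

/-- `Φ J` is axisymmetric for an axisymmetric scalar `Φ`. [folklore] -/
theorem isAxisymmetric_smul_rotGenL (hax : IsAxisymmetricScalar Φ) :
    IsAxisymmetric fun y => Φ y • rotGenL y := by
  intro θ x
  simp only [rotGenL_apply]
  rw [hax θ x, rotGen_rotZ]
  ext i
  fin_cases i <;> simp [rotZ_apply_zero, rotZ_apply_one] <;> ring

end Carrier

/-! ### The `L⁴` bound in Tao's class -/

section L4

variable {T ν : ℝ} {u₀ : EuclideanSpace ℝ (Fin 3) → EuclideanSpace ℝ (Fin 3)}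
  {u : ℝ → EuclideanSpace ℝ (Fin 3) → EuclideanSpace ℝ (Fin 3)} {p : ℝ → EuclideanSpace ℝ (Fin 3) → ℝ}

/-- `eLpNorm f 4 ≤ ofReal (S^{1/4})` from a bound `∫ ‖f‖⁴ ≤ S` for `‖f‖⁴` integrable. [folklore] -/
theorem eLpNorm_four_le_of_integral_le {f : EuclideanSpace ℝ (Fin 3) → EuclideanSpace ℝ (Fin 3)}
    (hf : Integrable (fun x => ‖f x‖ ^ 4) volume) {S : ℝ} (hS : ∫ x, ‖f x‖ ^ 4 ≤ S) :
    eLpNorm f 4 volume ≤ ENNReal.ofReal (S ^ (1 / 4 : ℝ)) := by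
  have hS0 : 0 ≤ S := (integral_nonneg fun x => by positivity).trans hS
  rw [eLpNorm_eq_lintegral_rpow_enorm_toReal (by norm_num) (by norm_num)]
  have h4 : (4 : ℝ≥0∞).toReal = 4 := by norm_num
  rw [h4]
  have hlin : ∫⁻ x, ‖f x‖ₑ ^ (4 : ℝ) = ENNReal.ofReal (∫ x, ‖f x‖ ^ 4) := by
    rw [ofReal_integral_eq_lintegral_ofReal hf (ae_of_all _ fun x => by positivity)]
    refine lintegral_congr fun x => ?_
    rw [← ofReal_norm, ENNReal.ofReal_rpow_of_nonneg (norm_nonneg _) (by norm_num)]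
    norm_cast
  rw [hlin, ← ENNReal.ofReal_rpow_of_nonneg hS0 (by norm_num)]
  exact ENNReal.rpow_le_rpow (ENNReal.ofReal_le_ofReal hS) (by norm_num)

/-- **The `L⁴` bound of the velocity from `∫ r²Φ⁴`, `∫ r²Ω²` and `‖Γ‖_∞`** (Tao's class, axisymmetric
slices).  If at time `t ∈ [0, T]`: `|Γ(t)| ≤ M`, `∫ (x₀² + x₁²) Φ(t)⁴ ≤ A` and `∫ (x₀² + x₁²) Ω(t)² ≤ Y`
(`Φ = angVelQuot`, `Ω = angVortQuot`), then
`‖u(t)‖_{L⁴} ≤ (A + M² · 2E(u₀))^{1/4} + (√(8E(u₀)) (K √Y)³)^{1/4}`, `E(u₀) = ½‖u₀‖²_{L²}`,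
`K` the Sobolev constant of `Ḣ¹(ℝ³) ⊂ L⁶`: split `u = Φ J + b`; `‖ΦJ‖⁴_4 = ∫ r⁴Φ⁴ ≤ A + M²‖u‖₂²`;
`b` is axisymmetric, swirl free, divergence free with `‖curl b‖² = r²Ω²` off the axis, so
`‖∇b‖₂² ≤ Y`, `‖b‖₆ ≤ K√Y`, `‖b‖₂ ≤ 2‖u‖₂`, `‖b‖⁴_4 ≤ ‖b‖₂‖b‖₆³`. [cite: LeiZhang2017, §4 (p. 10)] -/
theorem IsTaoSolutionOn.eLpNorm_four_le_of_bounds (h : IsTaoSolutionOn T ν u₀ u p) (hT : 0 < T)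
    (hν : 0 ≤ ν) (hax : ∀ t ∈ Icc 0 T, IsAxisymmetric (u t)) {t : ℝ} (ht : t ∈ Icc 0 T)
    {M : ℝ} (hM : ∀ x, |swirl (u t) x| ≤ M)
    {A : ℝ} (hA : ∫ x : EuclideanSpace ℝ (Fin 3), (x 0 ^ 2 + x 1 ^ 2) * angVelQuot (u t) x ^ 4 ≤ A)
    {Y : ℝ} (hY : ∫ x : EuclideanSpace ℝ (Fin 3), (x 0 ^ 2 + x 1 ^ 2) * angVortQuot (u t) x ^ 2 ≤ Y) :
    eLpNorm (u t) 4 volume ≤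
      ENNReal.ofReal ((A + M ^ 2 * (2 * VectorCalculus.kineticEnergy u₀)) ^ (1 / 4 : ℝ)) +
      ENNReal.ofReal ((Real.sqrt (4 * (2 * VectorCalculus.kineticEnergy u₀)) *
        ((SNormLESNormFDerivOfEqConst (EuclideanSpace ℝ (Fin 3))
          (volume : Measure (EuclideanSpace ℝ (Fin 3))) 2 : ℝ) * Real.sqrt Y) ^ 3) ^ (1 / 4 : ℝ)) := by
  -- Tao-class facts at `t`
  have hcl := h.classical
  have hu : ContDiff ℝ ∞ (u t) := hcl.contDiff_velocity ht
  have hu3 : ContDiff ℝ 3 (u t) := hu.of_le (by norm_cast)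
  have hu2 : ContDiff ℝ 2 (u t) := hu.of_le (by norm_cast)
  have hu1 : ContDiff ℝ 1 (u t) := hu.of_le (by norm_cast)
  have hud : Differentiable ℝ (u t) := hu.differentiable (by simp)
  have haxτ : IsAxisymmetric (u t) := hax t ht
  have hdiv : VectorCalculus.IsDivFree (u t) := hcl.divFree t ht
  have hH : ∀ n : ℕ, ∫⁻ x, ‖iteratedFDeriv ℝ n (u t) x‖ₑ ^ 2 < ⊤ := fun n => by
    obtain ⟨C, hC⟩ := h.sobolev n; exact (hC t ht).trans_lt ENNReal.coe_lt_top
  set KE : ℝ := VectorCalculus.kineticEnergy u₀ with hKE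
  have hKE0 : 0 ≤ KE := kineticEnergy_nonneg u₀
  have hL2u : ∫⁻ x, ‖u t x‖ₑ ^ 2 ≤ ENNReal.ofReal (2 * KE) := h.lintegral_enorm_sq_le hT hν ht
  set Φ : EuclideanSpace ℝ (Fin 3) → ℝ := angVelQuot (u t) with hΦ_def
  set Ω : EuclideanSpace ℝ (Fin 3) → ℝ := angVortQuot (u t) with hΩ_def
  have hΦ : ContDiff ℝ ∞ Φ := contDiff_angVelQuot_of_contDiff hu
  have hΦd : Differentiable ℝ Φ := hΦ.differentiable (by simp)
  have hΩc : ContDiff ℝ ∞ Ω := contDiff_angVortQuot_of_contDiff hu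
  have hΦax : IsAxisymmetricScalar Φ := haxτ.isAxisymmetricScalar_angVelQuot hu2
  have hρ0 : ∀ x : EuclideanSpace ℝ (Fin 3), 0 ≤ x 0 ^ 2 + x 1 ^ 2 := fun x => by positivity
  have hΓ : ∀ x : EuclideanSpace ℝ (Fin 3), swirl (u t) x = (x 0 ^ 2 + x 1 ^ 2) * Φ x := fun x => by
    rw [← cylRadius_sq]; exact (haxτ.cylRadius_sq_mul_angVelQuot hu2 x).symm
  have hρΦ : ∀ x : EuclideanSpace ℝ (Fin 3), (x 0 ^ 2 + x 1 ^ 2) * Φ x ^ 2 ≤ ‖u t x‖ ^ 2 := fun x =>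
    haxτ.horizSq_mul_angVelQuot_sq_le hu2 x
  have hM0 : 0 ≤ M := (abs_nonneg _).trans (hM 0)
  -- the carrier and the poloidal part
  set w : EuclideanSpace ℝ (Fin 3) → EuclideanSpace ℝ (Fin 3) := fun x => Φ x • rotGenL x with hw_def
  set b : EuclideanSpace ℝ (Fin 3) → EuclideanSpace ℝ (Fin 3) := fun x => u t x - w x with hb_def
  have hwC : ContDiff ℝ ∞ w := hΦ.smul rotGenL.contDiff
  have hbC : ContDiff ℝ ∞ b := hu.sub hwC
  have hwn : ∀ x, ‖w x‖ ^ 2 = (x 0 ^ 2 + x 1 ^ 2) * Φ x ^ 2 := fun x => norm_smul_rotGenL_sq (Φ x) x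
  have hwle : ∀ x, ‖w x‖ ≤ ‖u t x‖ := fun x => by
    have h2 : ‖w x‖ ^ 2 ≤ ‖u t x‖ ^ 2 := by rw [hwn]; exact hρΦ x
    exact le_of_sq_le_sq h2 (norm_nonneg _)
  have hble : ∀ x, ‖b x‖ ≤ 2 * ‖u t x‖ := fun x =>
    (norm_sub_le _ _).trans (by linarith [hwle x])
  have hsplit : u t = fun x => w x + b x := by funext x; simp only [hb_def]; abel
  ------------------------------------------------------------------
  -- Part 1: the swirl part `‖Φ J‖₄`
  ------------------------------------------------------------------
  have hpt : ∀ x : EuclideanSpace ℝ (Fin 3), ‖w x‖ ^ 4 ≤ (x 0 ^ 2 + x 1 ^ 2) * Φ x ^ 4 + M ^ 2 * ‖u t x‖ ^ 2 := by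
    intro x
    have hρ := hρ0 x
    have h4 : ‖w x‖ ^ 4 = (x 0 ^ 2 + x 1 ^ 2) ^ 2 * Φ x ^ 4 := by
      rw [show (4 : ℕ) = 2 * 2 from rfl, pow_mul, hwn]; ring
    rw [h4]
    rcases le_or_gt (x 0 ^ 2 + x 1 ^ 2) 1 with hle | hgt
    · have : (x 0 ^ 2 + x 1 ^ 2) ^ 2 * Φ x ^ 4 ≤ (x 0 ^ 2 + x 1 ^ 2) * Φ x ^ 4 := by
        have : 0 ≤ Φ x ^ 4 := by positivity
        nlinarith [mul_le_mul_of_nonneg_right hle (mul_nonneg hρ this)]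
      nlinarith [sq_nonneg M, norm_nonneg (u t x)]
    · have hΓx : ((x 0 ^ 2 + x 1 ^ 2) * Φ x) ^ 2 ≤ M ^ 2 := by
        rw [← hΓ x, ← sq_abs]; exact pow_le_pow_left₀ (abs_nonneg _) (hM x) 2
      have h1 : (x 0 ^ 2 + x 1 ^ 2) ^ 2 * Φ x ^ 4 = ((x 0 ^ 2 + x 1 ^ 2) * Φ x) ^ 2 * Φ x ^ 2 := by ring
      have h2 : Φ x ^ 2 ≤ (x 0 ^ 2 + x 1 ^ 2) * Φ x ^ 2 := by nlinarith [sq_nonneg (Φ x)]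
      have h3 : ((x 0 ^ 2 + x 1 ^ 2) * Φ x) ^ 2 * Φ x ^ 2 ≤ M ^ 2 * ‖u t x‖ ^ 2 :=
        mul_le_mul hΓx (h2.trans (hρΦ x)) (sq_nonneg _) (sq_nonneg _)
      have h5 : 0 ≤ (x 0 ^ 2 + x 1 ^ 2) * Φ x ^ 4 := by positivity
      linarith
  -- integrability of `ρ Φ⁴` and of `‖w‖⁴`
  have mΦ : MemLp Φ 2 volume := memLp_of_sobolev hΦ (haxτ.lintegral_sq_iteratedFDeriv_angVelQuot_lt_top hu hH)
  obtain ⟨B, -, hB⟩ := h.exists_bound_velocity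
  have hB₂ : ∀ x : EuclideanSpace ℝ (Fin 3), (x 0 ^ 2 + x 1 ^ 2) * Φ x ^ 2 ≤ B ^ 2 := fun x =>
    (hρΦ x).trans (pow_le_pow_left₀ (norm_nonneg _) (hB t ht x) 2)
  have cP : Continuous fun x : EuclideanSpace ℝ (Fin 3) => (x 0 ^ 2 + x 1 ^ 2) * Φ x ^ 2 :=
    (contDiff_horizSq (n := 0)).continuous.mul (hΦ.continuous.pow 2)
  have iA : Integrable (fun x : EuclideanSpace ℝ (Fin 3) => (x 0 ^ 2 + x 1 ^ 2) * Φ x ^ 4) volume :=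
    (mΦ.integrable_sq.bdd_mul cP.aestronglyMeasurable (ae_of_all _ fun x => by
      rw [Real.norm_of_nonneg (mul_nonneg (hρ0 x) (sq_nonneg _))]; exact hB₂ x)).congr
      (ae_of_all _ fun x => by simp only; ring)
  have hu2i : Integrable (fun x => ‖u t x‖ ^ 2) volume :=
    (memLp_two_iff_integrable_sq_norm (h.continuousL2.1 t ht).1).1 (h.continuousL2.1 t ht)
  have hA0 : 0 ≤ A := (integral_nonneg fun x => mul_nonneg (hρ0 x) (by positivity)).trans hA
  have iw4 : Integrable (fun x => ‖w x‖ ^ 4) volume :=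
    (iA.add (hu2i.const_mul (M ^ 2))).mono' (hwC.continuous.norm.pow 4).aestronglyMeasurable
      (ae_of_all _ fun x => by
        rw [Real.norm_of_nonneg (by positivity)]; exact hpt x)
  have hu2le : ∫ x, ‖u t x‖ ^ 2 ≤ 2 * KE := by
    have h1 : ∫ x, ‖u t x‖ ^ 2 = (∫⁻ x, ‖u t x‖ₑ ^ 2).toReal := by
      rw [integral_eq_lintegral_of_nonneg_ae (ae_of_all _ fun x => pow_nonneg (norm_nonneg _) _)
        (hu.continuous.norm.pow 2).aestronglyMeasurable]
      congr 1; exact lintegral_congr fun x => by rw [← ofReal_norm, ENNReal.ofReal_pow (norm_nonneg _)]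
    rw [h1]
    exact ENNReal.toReal_le_of_le_ofReal (by positivity) hL2u
  have hPart1 : eLpNorm w 4 volume ≤ ENNReal.ofReal ((A + M ^ 2 * (2 * KE)) ^ (1 / 4 : ℝ)) := by
    refine eLpNorm_four_le_of_integral_le iw4 ?_
    calc ∫ x, ‖w x‖ ^ 4 ≤ ∫ x : EuclideanSpace ℝ (Fin 3), ((x 0 ^ 2 + x 1 ^ 2) * Φ x ^ 4 + M ^ 2 * ‖u t x‖ ^ 2) :=
          integral_mono iw4 (iA.add (hu2i.const_mul _)) hpt
      _ = (∫ x : EuclideanSpace ℝ (Fin 3), (x 0 ^ 2 + x 1 ^ 2) * Φ x ^ 4) + M ^ 2 * ∫ x, ‖u t x‖ ^ 2 := by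
          rw [integral_add iA (hu2i.const_mul _), integral_const_mul]
      _ ≤ A + M ^ 2 * (2 * KE) := add_le_add hA (mul_le_mul_of_nonneg_left hu2le (sq_nonneg _))
  ------------------------------------------------------------------
  -- Part 2: the poloidal part `b`
  ------------------------------------------------------------------
  -- `b ∈ L²`
  have hbL2 : ∫⁻ x, ‖b x‖ₑ ^ 2 ≤ ENNReal.ofReal (4 * (2 * KE)) := by
    calc ∫⁻ x, ‖b x‖ₑ ^ 2 ≤ ∫⁻ x, ENNReal.ofReal 4 * ‖u t x‖ₑ ^ 2 := lintegral_mono fun x => by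
          rw [← ofReal_norm, ← ofReal_norm, ← ENNReal.ofReal_pow (norm_nonneg _),
            ← ENNReal.ofReal_pow (norm_nonneg _), ← ENNReal.ofReal_mul (by norm_num)]
          exact ENNReal.ofReal_le_ofReal (by nlinarith [hble x, norm_nonneg (b x), norm_nonneg (u t x)])
      _ = ENNReal.ofReal 4 * ∫⁻ x, ‖u t x‖ₑ ^ 2 := lintegral_const_mul' _ _ ENNReal.ofReal_ne_top
      _ ≤ ENNReal.ofReal 4 * ENNReal.ofReal (2 * KE) := by gcongr
      _ = ENNReal.ofReal (4 * (2 * KE)) := by rw [← ENNReal.ofReal_mul (by norm_num)]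
  have hbL2lt : ∫⁻ x, ‖b x‖ₑ ^ 2 < ⊤ := hbL2.trans_lt ENNReal.ofReal_lt_top
  have mb2 : MemLp b 2 volume := ⟨hbC.continuous.aestronglyMeasurable, eLpNorm_two_lt_top_of_lintegral_enorm_sq_lt_top hbL2lt⟩
  -- `b` is divergence free, axisymmetric, swirl free
  have hDsub : ∀ x, fderiv ℝ b x = fderiv ℝ (u t) x - fderiv ℝ w x := fun x =>
    fderiv_sub (hud x) (hwC.differentiable (by simp) x)
  have hbdiv : VectorCalculus.IsDivFree b := by
    intro x
    have h1 : VectorCalculus.divergence b x = VectorCalculus.divergence (u t) x - VectorCalculus.divergence w x := by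
      simp only [VectorCalculus.divergence, hDsub, ContinuousLinearMap.toLinearMap_sub, map_sub]
    rw [h1, hdiv x, divergence_smul_rotGenL hΦax (hΦd x), sub_zero]
  have hrotZsub : ∀ (θ : ℝ) (a c : EuclideanSpace ℝ (Fin 3)), rotZ θ (a - c) = rotZ θ a - rotZ θ c := by
    intro θ a c; ext i; fin_cases i <;> simp [rotZ_apply_zero, rotZ_apply_one] <;> ring
  have hbax : IsAxisymmetric b := by
    intro θ x
    have hw' : w (rotZ θ x) = rotZ θ (w x) := isAxisymmetric_smul_rotGenL hΦax θ x
    simp only [hb_def]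
    rw [haxτ θ x, hw', hrotZsub]
  have hbsw : HasNoSwirl b := by
    intro x
    have : swirl b x = swirl (u t) x - swirl w x := by simp only [swirl, hb_def, PiLp.sub_apply]; ring
    rw [this, hΓ x, swirl_smul_rotGenL]; ring
  -- `curl b` off the axis
  have hcurl_sub : ∀ x, FluidPDE.curl b x = FluidPDE.curl (u t) x - FluidPDE.curl w x := fun x => by
    rw [curl_eq_curlCLM, curl_eq_curlCLM, curl_eq_curlCLM, hDsub, map_sub]
  have hswirl_curl : ∀ x : EuclideanSpace ℝ (Fin 3), swirl (FluidPDE.curl b) x = (x 0 ^ 2 + x 1 ^ 2) * Ω x := by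
    intro x
    have : swirl (FluidPDE.curl b) x = swirl (FluidPDE.curl (u t)) x - swirl (FluidPDE.curl w) x := by
      simp only [swirl, hcurl_sub, PiLp.sub_apply]; ring
    rw [this, swirl_curl_smul_rotGenL (hΦd x), sub_zero, ← cylRadius_sq]
    exact (haxτ.cylRadius_sq_mul_angVortQuot hu3 x).symm
  have hcurl_off : ∀ x : EuclideanSpace ℝ (Fin 3), cylRadius x ≠ 0 →
      ‖FluidPDE.curl b x‖ ^ 2 = (x 0 ^ 2 + x 1 ^ 2) * Ω x ^ 2 := by
    intro x hx
    rw [norm_curl_sq_eq_swirlVelocity_sq hbax hbsw (hbC.of_le (by norm_cast)) (Or.inl hx)]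
    have hsv := swirl_eq_cylRadius_mul_swirlVelocity (FluidPDE.curl b) hx
    rw [hswirl_curl x, ← cylRadius_sq] at hsv
    have : swirlVelocity (FluidPDE.curl b) x = cylRadius x * Ω x := by
      have := mul_left_cancel₀ hx (hsv.symm.trans (by ring : cylRadius x ^ 2 * Ω x = cylRadius x * (cylRadius x * Ω x)))
      exact this
    rw [this, mul_pow, cylRadius_sq]
  have hcurl_ae : (fun x => ‖FluidPDE.curl b x‖ₑ ^ 2) =ᵐ[volume]
      fun x : EuclideanSpace ℝ (Fin 3) => ENNReal.ofReal ((x 0 ^ 2 + x 1 ^ 2) * Ω x ^ 2) := by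
    have hax0 : ∀ᵐ x : EuclideanSpace ℝ (Fin 3) ∂volume, x 0 ^ 2 + x 1 ^ 2 ≠ 0 := by
      have := volume_axis_eq_zero
      rw [ae_iff]; simpa using this
    filter_upwards [hax0] with x hx
    have hr : cylRadius x ≠ 0 := by
      intro h0; apply hx; rw [← cylRadius_sq, h0]; ring
    rw [← ofReal_norm, ← ENNReal.ofReal_pow (norm_nonneg _), hcurl_off x hr]
  -- `∫ ρ Ω² ≤ Y` in `ℝ≥0∞`
  have hP1 : ∀ x, cylRadius x * |Ω x| ≤ ‖FluidPDE.curl (u t) x‖ := fun x => haxτ.cylRadius_mul_abs_angVortQuot_le hu3 x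
  have mD1 : MemLp (fun x => ‖iteratedFDeriv ℝ 1 (u t) x‖) 2 volume :=
    memLp_two_of_norm_le_of_lintegral (hu.continuous_iteratedFDeriv (by exact_mod_cast le_top)).norm
      (fun x => by rw [norm_norm]) (hH 1)
  have mw0 : MemLp (fun x => ‖FluidPDE.curl (u t) x‖) 2 volume := by
    have c0 : 0 ≤ ‖(curlCLM : (EuclideanSpace ℝ (Fin 3) →L[ℝ] EuclideanSpace ℝ (Fin 3)) →L[ℝ]
        EuclideanSpace ℝ (Fin 3))‖ := by positivity
    refine memLp_of_norm_le_const_mul (contDiff_curl (n := (⊤ : ℕ∞)) (by exact_mod_cast hu)).continuous.norm c0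
      (fun x => ?_) mD1
    rw [norm_norm]
    have := norm_iteratedFDeriv_curl_le (n := 0) (by exact_mod_cast hu1) x
    rwa [norm_iteratedFDeriv_zero] at this
  have iY : Integrable (fun x : EuclideanSpace ℝ (Fin 3) => (x 0 ^ 2 + x 1 ^ 2) * Ω x ^ 2) volume := by
    refine mw0.integrable_sq.mono' ((contDiff_horizSq (n := 0)).continuous.mul (hΩc.continuous.pow 2)).aestronglyMeasurable
      (ae_of_all _ fun x => ?_)
    rw [Real.norm_of_nonneg (mul_nonneg (hρ0 x) (sq_nonneg _)), ← cylRadius_sq,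
      show cylRadius x ^ 2 * Ω x ^ 2 = (cylRadius x * |Ω x|) ^ 2 by rw [mul_pow, sq_abs]]
    exact pow_le_pow_left₀ (mul_nonneg (cylRadius_nonneg x) (abs_nonneg _)) (hP1 x) 2
  have hY0 : 0 ≤ Y := (integral_nonneg fun x => mul_nonneg (hρ0 x) (sq_nonneg _)).trans hY
  have hcurlY : ∫⁻ x, ‖FluidPDE.curl b x‖ₑ ^ 2 ≤ ENNReal.ofReal Y := by
    rw [lintegral_congr_ae hcurl_ae, ← ofReal_integral_eq_lintegral_ofReal iY
      (ae_of_all _ fun x => mul_nonneg (hρ0 x) (sq_nonneg _))]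
    exact ENNReal.ofReal_le_ofReal hY
  -- `‖∇b‖₂ ≤ √Y` (div–curl)
  have hfrob := lintegral_frobeniusNormSq_fderiv_le_lintegral_sq_norm_curl (hbC.of_le (by norm_cast)) hbdiv hbL2lt
  have hDb : eLpNorm (fderiv ℝ b) 2 volume ≤ ENNReal.ofReal (Real.sqrt Y) := by
    rw [eLpNorm_eq_lintegral_rpow_enorm_toReal (by norm_num) (by norm_num)]
    have h2 : (2 : ℝ≥0∞).toReal = 2 := by norm_num
    rw [h2]
    have h1 : ∫⁻ x, ‖fderiv ℝ b x‖ₑ ^ (2 : ℝ) ≤ ENNReal.ofReal Y := by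
      refine (lintegral_mono fun x => ?_).trans (hfrob.trans hcurlY)
      rw [← ofReal_norm, ENNReal.ofReal_rpow_of_nonneg (norm_nonneg _) (by norm_num)]
      refine ENNReal.ofReal_le_ofReal ?_
      have := sq_opNorm_le_frobeniusNormSq (fderiv ℝ b x)
      exact_mod_cast this
    calc (∫⁻ x, ‖fderiv ℝ b x‖ₑ ^ (2 : ℝ)) ^ (1 / (2 : ℝ)) ≤ (ENNReal.ofReal Y) ^ (1 / (2 : ℝ)) :=
          ENNReal.rpow_le_rpow h1 (by norm_num)
      _ = ENNReal.ofReal (Real.sqrt Y) := by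
          rw [Real.sqrt_eq_rpow, ENNReal.ofReal_rpow_of_nonneg hY0 (by norm_num)]
  -- Sobolev: `‖b‖₆ ≤ K √Y`
  set K : ℝ≥0 := SNormLESNormFDerivOfEqConst (EuclideanSpace ℝ (Fin 3))
    (volume : Measure (EuclideanSpace ℝ (Fin 3))) 2 with hK
  have hSob := eLpNorm_six_le_eLpNorm_fderiv_two (volume : Measure (EuclideanSpace ℝ (Fin 3)))
    finrank_euclideanSpace_fin (hbC.of_le (by norm_cast)) mb2.2
  have hb6 : eLpNorm b 6 volume ≤ ENNReal.ofReal ((K : ℝ) * Real.sqrt Y) := by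
    refine hSob.trans ?_
    rw [ENNReal.ofReal_mul K.coe_nonneg, ENNReal.ofReal_coe_nnreal]
    gcongr
  have mb6 : MemLp b 6 volume := ⟨hbC.continuous.aestronglyMeasurable, hb6.trans_lt ENNReal.ofReal_lt_top⟩
  -- `∫ ‖b‖⁴ ≤ √(∫‖b‖²) √(∫‖b‖⁶)`
  have hI4 := integral_norm_pow_four_le mb2 mb6
  have hb2int : ∫ x, ‖b x‖ ^ 2 ≤ 4 * (2 * KE) := by
    have h1 : ∫ x, ‖b x‖ ^ 2 = (∫⁻ x, ‖b x‖ₑ ^ 2).toReal := by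
      rw [integral_eq_lintegral_of_nonneg_ae (ae_of_all _ fun x => pow_nonneg (norm_nonneg _) _)
        (hbC.continuous.norm.pow 2).aestronglyMeasurable]
      congr 1; exact lintegral_congr fun x => by rw [← ofReal_norm, ENNReal.ofReal_pow (norm_nonneg _)]
    rw [h1]; exact ENNReal.toReal_le_of_le_ofReal (by positivity) hbL2
  have hb6int : ∫ x, ‖b x‖ ^ 6 ≤ ((K : ℝ) * Real.sqrt Y) ^ 6 := by
    have h6 : (6 : ℝ≥0∞).toReal = 6 := by norm_num
    have hlin : ∫⁻ x, ‖b x‖ₑ ^ (6 : ℝ) ≤ ENNReal.ofReal (((K : ℝ) * Real.sqrt Y) ^ 6) := by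
      have := hb6
      rw [eLpNorm_eq_lintegral_rpow_enorm_toReal (by norm_num) (by norm_num), h6] at this
      have hKY : 0 ≤ (K : ℝ) * Real.sqrt Y := mul_nonneg K.coe_nonneg (Real.sqrt_nonneg _)
      have h' := ENNReal.rpow_le_rpow this (show (0 : ℝ) ≤ 6 by norm_num)
      rw [← ENNReal.rpow_mul, show (1 / (6 : ℝ)) * 6 = 1 by norm_num, ENNReal.rpow_one,
        ENNReal.ofReal_rpow_of_nonneg (p := (6 : ℝ)) hKY (by norm_num)] at h'
      refine h'.trans_eq ?_
      congr 1
      exact_mod_cast Real.rpow_natCast _ 6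
    have hi6 : Integrable (fun x => ‖b x‖ ^ 6) volume := by
      have := mb6.integrable_norm_rpow (by norm_num) (by norm_num)
      rw [h6] at this
      exact this.congr (ae_of_all _ fun x => by norm_cast)
    have h1 : ∫ x, ‖b x‖ ^ 6 = (∫⁻ x, ‖b x‖ₑ ^ (6 : ℝ)).toReal := by
      rw [integral_eq_lintegral_of_nonneg_ae (ae_of_all _ fun x => pow_nonneg (norm_nonneg _) _)
        (hbC.continuous.norm.pow 6).aestronglyMeasurable]
      congr 1; exact lintegral_congr fun x => by
        rw [← ofReal_norm, ENNReal.ofReal_rpow_of_nonneg (norm_nonneg _) (by norm_num)]; norm_cast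
    rw [h1]; exact ENNReal.toReal_le_of_le_ofReal (by positivity) hlin
  have hKY0 : 0 ≤ (K : ℝ) * Real.sqrt Y := mul_nonneg K.coe_nonneg (Real.sqrt_nonneg _)
  have hb4int : ∫ x, ‖b x‖ ^ 4 ≤ Real.sqrt (4 * (2 * KE)) * ((K : ℝ) * Real.sqrt Y) ^ 3 := by
    refine hI4.trans (mul_le_mul (Real.sqrt_le_sqrt hb2int) ?_ (Real.sqrt_nonneg _) (Real.sqrt_nonneg _))
    calc Real.sqrt (∫ x, ‖b x‖ ^ 6) ≤ Real.sqrt (((K : ℝ) * Real.sqrt Y) ^ 6) := Real.sqrt_le_sqrt hb6int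
      _ = ((K : ℝ) * Real.sqrt Y) ^ 3 := by
          rw [show (6 : ℕ) = 3 * 2 from rfl, pow_mul, Real.sqrt_sq (by positivity)]
  have hi4 : Integrable (fun x => ‖b x‖ ^ 4) volume := by
    have hi6 : Integrable (fun x => ‖b x‖ ^ 6) volume := by
      have h6 : (6 : ℝ≥0∞).toReal = 6 := by norm_num
      have := mb6.integrable_norm_rpow (by norm_num) (by norm_num)
      rw [h6] at this
      exact this.congr (ae_of_all _ fun x => by norm_cast)
    have hb2i : Integrable (fun x => ‖b x‖ ^ 2) volume := (memLp_two_iff_integrable_sq_norm mb2.1).1 mb2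
    have hsum : Integrable (fun x => ‖b x‖ ^ 2 + ‖b x‖ ^ 6) volume := hb2i.add hi6
    refine hsum.mono' (hbC.continuous.norm.pow 4).aestronglyMeasurable (ae_of_all _ fun x => ?_)
    rw [Real.norm_of_nonneg (by positivity)]
    have h0 := norm_nonneg (b x)
    nlinarith [mul_nonneg (sq_nonneg ‖b x‖) (sq_nonneg (‖b x‖ ^ 2 - 1)), pow_nonneg h0 4]
  have hPart2 : eLpNorm b 4 volume ≤
      ENNReal.ofReal ((Real.sqrt (4 * (2 * KE)) * ((K : ℝ) * Real.sqrt Y) ^ 3) ^ (1 / 4 : ℝ)) :=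
    eLpNorm_four_le_of_integral_le hi4 hb4int
  ------------------------------------------------------------------
  -- Part 3: Minkowski
  ------------------------------------------------------------------
  rw [hsplit]
  exact (eLpNorm_add_le hwC.continuous.aestronglyMeasurable hbC.continuous.aestronglyMeasurable
    (by norm_num)).trans (add_le_add hPart1 hPart2)

end L4

end Literature.Analysis.FluidPDE

end
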